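import Literature.Computability.MetaComplexity.FpLinearSystemsProofs
import HarnessLib

/-!
# Gallager's bit-regular LDPC ensemble has members without light codewords
# (unique-neighbour expansion of random bipartite graphs: Sipser–Spielman 1996 Thm 7 / Richardson–Urbanke Thms 8.2, 8.7)

This file PROVES (no named fact) the probabilistic half of the existence of asymptotically good low-density
parity-check codes: in the ensemble where each of `2n` bits picks `4` of `n` checks independently and uniformly
(the tree's sample space `PickSpace (2n) 4 n 2` of `Literature/Computability/MetaComplexity/FpLinearSystemsProofs.lean`,
rows = bits, columns = checks, a row of the sample matrix = the mod-2 indicator of the bit's picks), SOME sample has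
no non-zero vector `v` over `𝔽₂` with `Σ_i v_i row_i = 0` and `|supp v| ≤ n/650` — i.e. the binary code whose
parity-check matrix is the TRANSPOSE of the sample matrix (`n` checks, `2n` bits, column weight `≤ 4`) has minimum
distance `> n/650` (`exists_sample_no_light_kernel`).

The argument is the printed one (Richardson–Urbanke, *Modern Coding Theory*, Thm 8.2 "Expansion and minimum
distance": every check neighbour of the support of a codeword is met at least twice, so the support has at most
`|supp|·4/2` check neighbours; Thm 8.7 / Sipser–Spielman: a random bit-regular graph expands small sets, by a union
bound over the confining check sets) made a finite COUNT, and it is literally the "small supports / unique-neighbour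
regime" of the tree's Beck–Impagliazzo count (`card_kernel_small_le`: the samples killing a fixed `v` with
`|supp v| = s` are at most `C(n,2s)(2s/n)^{4s}|Ω|`), summed with this file's constants:
`Σ_{s=1}^{n/650} C(2n,s)·C(n,2s)(2s/n)^{4s} ≤ Σ_s (8e³s/n)^s ≤ Σ_s 4^{-s} ≤ 1/3` (`ldpc_small_support_bound`).
The companion files `LDPCCheckSplitting.lean` (a good sample ↦ an honest LDPC parity-check matrix: check degrees
made `≤ 8` by splitting checks, which only shrinks the code; full-rank row selection) and `GoodLDPCCodesExist.lean`
(the existence theorem with explicit parameters) finish the classical statement.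

References: R. G. Gallager, *Low-Density Parity-Check Codes*, MIT Press 1963 (the ensemble and the linear
minimum distance of almost all of its members, Ch. 2); M. Sipser, D. A. Spielman, *Expander codes*, IEEE Trans.
Inform. Theory 42 (1996) 1710–1722, Thm 7 (expansion ⇒ distance; quoted as Blake, *Essays on Coding Theory*
(CUP 2024) Thm 11.14, p. 279); T. Richardson, R. Urbanke, *Modern Coding Theory* (CUP 2008), Def. 8.1, Thm 8.2
(p. 428), Thm 8.7 (§8.4, p. 431).
-/

namespace Literature.InformationTheory.Coding

open Finset Real Literature.Computability.MetaComplexity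

/-! ### The union bound over light supports -/

/-- **Small supports are never killed by most samples** (the unique-neighbour regime with this file's constants):
in the ensemble `PickSpace (2n) 4 n 2` (each of `2n` bits picks `4` of `n ≥ 1` checks), the total number of pairs
(sample, non-zero `v` with `1 ≤ |supp v| ≤ n/650` and `Σ v_i row_i = 0`) is at most `|Ω|/3`:
`Σ_{s=1}^{n/650} Σ_{|supp v| = s} #{ω : v ∈ ker} ≤ Σ_s C(2n,s) C(n,2s) (2s/n)^{4s} |Ω| ≤ Σ_s (8e³s/n)^s |Ω| ≤ |Ω|/3`.
[cite: RichardsonUrbanke2008, Thm 8.7 (§8.4, p. 431: expansion of random regular ensembles, union bound (8.10)) and Thm 8.2 (p. 428)] -/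
theorem ldpc_small_support_bound {n : ℕ} (hn : 1 ≤ n) :
    ∑ s ∈ Finset.Icc 1 (n / 650), ∑ v ∈ vecsOfCard (2 * n) 2 s,
        ((kernelEvent (2 * 2) n v).card : ℝ) ≤
      (Fintype.card (PickSpace (2 * n) (2 * 2) n 2) : ℝ) / 3 := by
  classical
  have hnpos : (0 : ℝ) < n := by exact_mod_cast hn
  set N := (Fintype.card (PickSpace (2 * n) (2 * 2) n 2) : ℝ) with hN
  have hNnn : 0 ≤ N := Nat.cast_nonneg _
  -- the numerical constant: `8e³/650 ≤ 1/4`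
  have hβ : 8 * Real.exp 1 ^ 3 / 650 ≤ 1 / 4 := by
    have he := Real.exp_one_lt_d9
    have he0 := Real.exp_pos 1
    have h3 : Real.exp 1 ^ 3 < 2.7182818286 ^ 3 := by
      exact pow_lt_pow_left₀ he he0.le (by norm_num)
    nlinarith
  -- per `s`
  have hterm : ∀ s ∈ Finset.Icc 1 (n / 650),
      ∑ v ∈ vecsOfCard (2 * n) 2 s, ((kernelEvent (2 * 2) n v).card : ℝ) ≤ (1 / 4 : ℝ) ^ s * N := by
    intro s hs
    obtain ⟨hs1, hs0⟩ := Finset.mem_Icc.1 hs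
    have h650 : 650 * s ≤ n := by
      have := Nat.div_mul_le_self n 650
      nlinarith
    have hsR : (0 : ℝ) < s := by exact_mod_cast hs1
    -- each vector: the small-regime bound of the tree (`card_kernel_small_le`, `d' = 2`)
    have hv : ∀ v ∈ vecsOfCard (2 * n) 2 s, ((kernelEvent (2 * 2) n v).card : ℝ) ≤
        (n.choose (s * 2) : ℝ) * N * (((s * 2 : ℕ) : ℝ) / n) ^ (s * (2 * 2)) := by
      intro v hv
      have hcard := mem_vecsOfCard.1 hv
      have := card_kernel_small_le (m := 2 * n) (n := n) (p := 2) (d' := 2) (by omega) v (vsupp_spec v) (by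
        rw [hcard]; omega)
      rwa [hcard] at this
    calc ∑ v ∈ vecsOfCard (2 * n) 2 s, ((kernelEvent (2 * 2) n v).card : ℝ)
        ≤ ∑ v ∈ vecsOfCard (2 * n) 2 s, (n.choose (s * 2) : ℝ) * N * (((s * 2 : ℕ) : ℝ) / n) ^ (s * (2 * 2)) :=
          Finset.sum_le_sum hv
      _ = ((vecsOfCard (2 * n) 2 s).card : ℝ) *
            ((n.choose (s * 2) : ℝ) * (((s * 2 : ℕ) : ℝ) / n) ^ (s * (2 * 2)) * N) := by
          rw [Finset.sum_const, nsmul_eq_mul]; ring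
      _ ≤ (((2 * n).choose s : ℝ) * ((2 : ℝ) - 1) ^ s) * ((Real.exp 1 * (s * 2 : ℕ) / n) ^ (s * 2) * N) := by
          apply mul_le_mul _ _ (by positivity) (mul_nonneg (Nat.cast_nonneg _) (pow_nonneg (by norm_num) s))
          · have := card_vsupp_card_eq_le (m := 2 * n) (p := 2) s
            push_cast at this ⊢
            exact this
          · apply mul_le_mul_of_nonneg_right _ hNnn
            exact choose_mul_pow_le (by omega) (by omega) (by omega) (by nlinarith)
      _ ≤ ((Real.exp 1 * (2 * n : ℕ) / s) ^ s * ((2 : ℝ) - 1) ^ s) *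
            ((Real.exp 1 * (s * 2 : ℕ) / n) ^ (s * 2) * N) := by
          apply mul_le_mul_of_nonneg_right _ (by positivity)
          exact mul_le_mul_of_nonneg_right (choose_le_epow (2 * n) hs1) (pow_nonneg (by norm_num) s)
      _ = ((Real.exp 1 * (2 * n : ℕ) / s) * (Real.exp 1 * (s * 2 : ℕ) / n) ^ 2) ^ s * N := by
          rw [show ((2 : ℝ) - 1) = 1 by norm_num, one_pow, mul_one, mul_pow, ← pow_mul, mul_comm 2 s]
          ring
      _ = (8 * Real.exp 1 ^ 3 * ((s : ℝ) / n)) ^ s * N := by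
          congr 2
          push_cast
          field_simp
          ring
      _ ≤ (1 / 4 : ℝ) ^ s * N := by
          apply mul_le_mul_of_nonneg_right _ hNnn
          apply pow_le_pow_left₀ (by positivity)
          have hsn : (s : ℝ) / n ≤ 1 / 650 := by
            rw [div_le_div_iff₀ hnpos (by norm_num)]
            have : ((650 * s : ℕ) : ℝ) ≤ n := by exact_mod_cast h650
            push_cast at this
            linarith
          calc 8 * Real.exp 1 ^ 3 * ((s : ℝ) / n) ≤ 8 * Real.exp 1 ^ 3 * (1 / 650) := by
                gcongr
            _ = 8 * Real.exp 1 ^ 3 / 650 := by ring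
            _ ≤ 1 / 4 := hβ
  -- sum the geometric series
  calc ∑ s ∈ Finset.Icc 1 (n / 650), ∑ v ∈ vecsOfCard (2 * n) 2 s, ((kernelEvent (2 * 2) n v).card : ℝ)
      ≤ ∑ s ∈ Finset.Icc 1 (n / 650), (1 / 4 : ℝ) ^ s * N := Finset.sum_le_sum hterm
    _ = (∑ s ∈ Finset.Ico 1 (n / 650 + 1), (1 / 4 : ℝ) ^ s) * N := by
        rw [Finset.sum_mul]; rfl
    _ ≤ ((1 / 4 : ℝ) ^ 1 / (1 - 1 / 4)) * N :=
        mul_le_mul_of_nonneg_right (geom_sum_Ico_le_of_lt_one (by norm_num) (by norm_num)) hNnn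
    _ = N / 3 := by ring

/-- **A good sample exists (Gallager's ensemble has members without light codewords).** For every `n ≥ 1`
there is a sample `ω` — `2n` bits each picking `4` of `n` checks — such that every non-zero `v ∈ 𝔽₂^{2n}` with
`Σ_i v_i row_i(ω) = 0` (i.e. every non-zero word of the binary code whose parity checks are the columns of the
sample matrix) has support of size `> n/650`. Probabilistic method made a finite count: the bad samples number
`≤ |Ω|/3 < |Ω|` (`ldpc_small_support_bound`).
[cite: Gallager1963, Ch. 2 (ensemble of low-density parity-check codes; minimum distance of almost all codes grows linearly)] [cite: RichardsonUrbanke2008, Thm 8.2 (p. 428) and Thm 8.7 (§8.4, p. 431)] -/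
theorem exists_sample_no_light_kernel {n : ℕ} (hn : 1 ≤ n) :
    ∃ ω : PickSpace (2 * n) 4 n 2, ∀ v : Fin (2 * n) → ZMod 2, v ≠ 0 →
      (∀ j, combVec ω v j = 0) → n / 650 < (vsupp v).card := by
  classical
  set N := (Fintype.card (PickSpace (2 * n) (2 * 2) n 2) : ℝ) with hN
  -- the bad samples
  set B : Finset (PickSpace (2 * n) (2 * 2) n 2) := univ.filter fun ω =>
    ∃ v : Fin (2 * n) → ZMod 2, v ≠ 0 ∧ (vsupp v).card ≤ n / 650 ∧ ∀ j, combVec ω v j = 0 with hB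
  have hBsub : B ⊆ (Finset.Icc 1 (n / 650)).biUnion fun s => (vecsOfCard (2 * n) 2 s).biUnion fun v =>
      kernelEvent (2 * 2) n v := by
    intro ω hω
    obtain ⟨v, hv0, hvs, hker⟩ := (Finset.mem_filter.1 hω).2
    refine Finset.mem_biUnion.2 ⟨(vsupp v).card, Finset.mem_Icc.2 ⟨vsupp_card_pos hv0, hvs⟩, ?_⟩
    exact Finset.mem_biUnion.2 ⟨v, mem_vecsOfCard.2 rfl, mem_kernelEvent.2 hker⟩
  have hBcard : (B.card : ℝ) ≤ N / 3 := by
    calc (B.card : ℝ)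
        ≤ (((Finset.Icc 1 (n / 650)).biUnion fun s => (vecsOfCard (2 * n) 2 s).biUnion fun v =>
            kernelEvent (2 * 2) n v).card : ℝ) := by exact_mod_cast Finset.card_le_card hBsub
      _ ≤ ∑ s ∈ Finset.Icc 1 (n / 650), (((vecsOfCard (2 * n) 2 s).biUnion fun v =>
            kernelEvent (2 * 2) n v).card : ℝ) := by exact_mod_cast Finset.card_biUnion_le
      _ ≤ ∑ s ∈ Finset.Icc 1 (n / 650), ∑ v ∈ vecsOfCard (2 * n) 2 s, ((kernelEvent (2 * 2) n v).card : ℝ) := by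
          refine Finset.sum_le_sum fun s _ => ?_
          exact_mod_cast Finset.card_biUnion_le
      _ ≤ N / 3 := ldpc_small_support_bound hn
  have hNpos : 0 < N := by
    rw [hN, card_pickSpace]
    have : 0 < (n * (2 - 1)) ^ (2 * n * (2 * 2)) := pow_pos (by omega) _
    exact_mod_cast this
  have hlt : B.card < (univ : Finset (PickSpace (2 * n) (2 * 2) n 2)).card := by
    rw [Finset.card_univ]
    have : (B.card : ℝ) < N := by linarith
    rw [hN] at this
    exact_mod_cast this
  obtain ⟨ω, -, hω⟩ := Finset.exists_mem_notMem_of_card_lt_card hlt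
  refine ⟨ω, fun v hv0 hker => ?_⟩
  by_contra hle
  exact hω (Finset.mem_filter.2 ⟨Finset.mem_univ _, v, hv0, not_lt.1 hle, hker⟩)

end Literature.InformationTheory.Coding
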